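import Mathlib
import Summits.QuantumFields.YangMills.Theorems.UnitScaleTiltHistoryTailBoundedHeight
import Summits.QuantumFields.YangMills.Theorems.CoarseStiffnessTailCappedCoarseStiffnessLWedgeFloor

/-!
# Route `HistoryWedge` — THE CORNER `m = 1` OF THE HISTORY WEDGE HOLDS UNCONDITIONALLY: the bodies of `WedgeTailL` (stmt-QuantumFields-27959)
# and of `UnitScaleTilt.HistoryTailL` (stmt-QuantumFields-19936) at `m = 1` are theorems (BC5-adjacent rung; seat `ym-line-cst-p1` g7)

THE OBSERVATION.  On the history wedge `K ≤ m·(K − j + 1)` the depth `j` is at most `(m−1)(K−j+1) + 1`; at `m = 1` this is `j ≤ 1` — ONE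
block-averaging step below the plaquette, a BOUNDED DEPTH, where the per-plaquette Gaussian schema is an unconditional theorem of the tree
(`HistoryTailBoundedHeight.unitScaleTilt_perPlaquette_boundedHeight 1`: crude Prop 1 for (0.4) + reflection positivity at the finest height +
union bound, rate `¼(151L²)^{−2}`).  Hence, for EVERY family `F`, coupling `0 < γ ≤ 1` and profile `b₀ > 0`, `p₀ ≥ 1`:

* **`historyTailAt_one`** — `HistoryTailAt F γ b₀ p₀ 1` (K2's body at `m = 1`: the UV-small-history event `histGood K K` constrains only the bare
  field of run `K`, `histGood (K+1) K` the bare and the once-averaged field of run `K+1`; summable Gibbs mass of the complements) —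
  `T3AveragedTailProfile.historyTailAt_of_perPlaquetteOnWedge` at `m = 1`;
* **`wedgeTailAt_one`** — the body of `WedgeTailL` at `m = 1`: `Gibbs_K{θ(K−j) ≤ |Ū^j(∂p) − 1|} ≤ D·ρ^{K−j}` with `ρ = 1/(2L³)`, `ρL³ = ½ < 1`, for all
  `1 ≤ j ≤ K ≤ 1·(K − j + 1)` (`CoarseStiffnessTailWedgeFloor.schema_le_geometric`);
* **`historyTailL_face_one`**, **`wedgeTailL_face_one`** — the same in the quantifier shape of `HistoryTailL` / `WedgeTailL` with `m` frozen to `1`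
  (`b₀ = max b₁ 1`, `p₀ = max p₁ 3`, `γ₁ = 1`).

HONEST SCOPE.  A TOY CORNER: the consumer `UnitScaleTilt.closes` needs `m ≥ m₀(ε, L)` of the K1 items (19200/20520), and for `m ≥ 2` the wedge allows
depth linear in the height — the located RG content ([Balaban1985UV3] (71) p.273 integrated) is untouched.  `WedgeTailL`, `HistoryTailL` and every
crux of the organ stay OPEN; `YM3TorusSU2` (rung R3, a RECORD rung, not the Clay statement) is NOT proved; the Yang–Mills mass gap is NOT touched.

References: T. Bałaban, CMP **102** (1985) 255–275 [Balaban1985UV3] ((7) p.257, (71) p.273); T. Bałaban, CMP **98** (1985) 17–51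
[Balaban1985Averaging] (Prop. 1); J. Fröhlich, R. Israel, E. Lieb, B. Simon, CMP **62** (1978) 1–34 [FrohlichIsraelLiebSimon1978] (Thm 4.1).
-/

noncomputable section

namespace Summit.QuantumFields.YangMills.Theorems.HistoryWedgeCornerOne

open MeasureTheory
open Literature.MathematicalPhysics.QuantumFieldTheory
open Literature.MathematicalPhysics.QuantumFieldTheory.Balaban1983to89
open Literature.MathematicalPhysics.QuantumFieldTheory.Balaban1983to89.T3ContinuumYM3Torus
open Literature.MathematicalPhysics.QuantumFieldTheory.Balaban1983to89.T3UnitScaleTilt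
open Literature.MathematicalPhysics.QuantumFieldTheory.Balaban1983to89.T3UnitLawDensityEML
open Literature.MathematicalPhysics.QuantumFieldTheory.Balaban1983to89.T3AveragedTailProfile (historyTailAt_of_perPlaquetteOnWedge)
open Summit.QuantumFields.YangMills.Theorems.HistoryTailBoundedHeight (unitScaleTilt_perPlaquette_boundedHeight)
open Summit.QuantumFields.YangMills.Theorems.CoarseStiffnessTailWedgeFloor (schema_le_geometric)

/-- On the wedge with `m = 1` only the depth `j = 1` occurs (`1 ≤ j ≤ K`, `K ≤ 1·(K − j + 1)` force `j = 1`). [folklore] -/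
theorem eq_one_of_wedge_one {K j : ℕ} (hj1 : 1 ≤ j) (hjK : j ≤ K) (hw : K ≤ 1 * (K - j + 1)) : j = 1 := by
  omega

/-- **K2's BODY AT `m = 1` HOLDS** (every family `F`, `0 < γ ≤ 1`, `0 < b₀`, `1 ≤ p₀`): `HistoryTailAt F γ b₀ p₀ 1` — the per-plaquette schema is
demanded by `historyTailAt_of_perPlaquetteOnWedge` only at depth `j = 1`, where `unitScaleTilt_perPlaquette_boundedHeight 1` supplies it
unconditionally. [cite: Balaban1985UV3, (7) p.257 and (71) p.273] -/
theorem historyTailAt_one (F : T3Family) {γ b₀ p₀ : ℝ} (hγ : 0 < γ) (hγ1 : γ ≤ 1) (hb₀ : 0 < b₀) (hp₀ : 1 ≤ p₀) :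
    HistoryTailAt F γ b₀ p₀ 1 := by
  obtain ⟨C, A, c, hC, hc, h⟩ := unitScaleTilt_perPlaquette_boundedHeight 1 F hγ hγ1 hb₀.le p₀
  exact historyTailAt_of_perPlaquetteOnWedge F hγ hγ1 hb₀ hp₀ one_pos
    ⟨C, A, c, hC, hc, fun K j hj1 hjK hw p => h K j hjK (eq_one_of_wedge_one hj1 hjK hw).le p⟩

/-- **`WedgeTailL`'s BODY AT `m = 1` HOLDS** (every family `F`, `0 < γ ≤ 1`, `0 < b₀`, `1 ≤ p₀`): there are `D ≥ 0` and `ρ = 1/(2L³)` (`ρL³ = ½ < 1`)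
with `Gibbs_K{θ(K−j) ≤ |Ū^j(∂p) − 1|} ≤ D·ρ^{K−j}` for all `1 ≤ j ≤ K ≤ 1·(K − j + 1)` and all plaquettes `p` of height `j` — bounded depth `1` plus
`schema_le_geometric`. [cite: Balaban1985UV3, (7) p.257 and (71) p.273] -/
theorem wedgeTailAt_one (F : T3Family) {γ b₀ p₀ : ℝ} (hγ : 0 < γ) (hγ1 : γ ≤ 1) (hb₀ : 0 < b₀) (hp₀ : 1 ≤ p₀) :
    ∃ (D ρ : ℝ), 0 ≤ D ∧ 0 ≤ ρ ∧ ρ * (F.L : ℝ) ^ 3 < 1 ∧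
      ∀ (K j : ℕ), 1 ≤ j → j ≤ K → K ≤ 1 * (K - j + 1) → ∀ (p : Plaq (F.P K) j),
        (gibbsK F ℰp γ K).real
            {U | θBal F.L γ b₀ p₀ (K - j) ≤
              GaugeGroup.dist1 (GaugeField.plaqHol
                (Averaging.iter (fun i => BlockAveraging.blockAvg (P := F.P K) (j := i) ℰp) j U) p)} ≤ D * ρ ^ (K - j) := by
  obtain ⟨C, A, c, hC, hc, h⟩ := unitScaleTilt_perPlaquette_boundedHeight 1 F hγ hγ1 hb₀.le p₀
  obtain ⟨D, hD, hgeo⟩ := schema_le_geometric F hγ hγ1 hb₀ hp₀ hC A hc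
  have hL1 : (1 : ℝ) < F.L := by exact_mod_cast F.hL.2
  refine ⟨D, 1 / (2 * (F.L : ℝ) ^ 3), hD, by positivity, ?_, fun K j hj1 hjK hw p => ?_⟩
  · rw [one_div, inv_mul_eq_div, div_lt_one (by positivity)]
    linarith [show (0 : ℝ) < (F.L : ℝ) ^ 3 by positivity]
  · exact (h K j hjK (eq_one_of_wedge_one hj1 hjK hw).le p).trans (hgeo (K - j))

/-- **THE `m = 1` FACE OF `UnitScaleTilt.HistoryTailL`** in its own quantifier shape (`b₀ = max b₁ 1`, `p₀ = max p₁ 3`, `γ₁ = 1`): for every `L`,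
`b₁`, `p₁` and every family with `F.L = L`, `0 < γ ≤ 1`, `HistoryTailAt F γ b₀ p₀ 1`.  `HistoryTailL` itself (all `m ≥ 1`) stays OPEN.
[cite: Balaban1985UV3, (71) p.273] -/
theorem historyTailL_face_one :
    ∀ (L : ℕ) (b₁ p₁ : ℝ), ∃ (b₀ p₀ : ℝ), b₁ ≤ b₀ ∧ p₁ ≤ p₀ ∧ 0 < b₀ ∧ 2 < p₀ ∧
      ∃ γ₁ : ℝ, 0 < γ₁ ∧ ∀ (F : T3Family) (γ : ℝ), F.L = L → 0 < γ → γ ≤ γ₁ → HistoryTailAt F γ b₀ p₀ 1 := by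
  intro L b₁ p₁
  refine ⟨max b₁ 1, max p₁ 3, le_max_left _ _, le_max_left _ _, lt_of_lt_of_le one_pos (le_max_right _ _),
    lt_of_lt_of_le (by norm_num) (le_max_right _ _), 1, one_pos, fun F γ _ hγ hγ1 => ?_⟩
  exact historyTailAt_one F hγ hγ1 (lt_of_lt_of_le one_pos (le_max_right _ _)) (by linarith [le_max_right p₁ 3])

/-- **THE `m = 1` FACE OF `HistoryWedge.WedgeTailL`** in its own quantifier shape (`b₀ = max b₁ 1`, `p₀ = max p₁ 3`, `γ₁ = 1`, `ρ = 1/(2L³)`).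
`WedgeTailL` itself (all `m ≥ 1`) stays OPEN. [cite: Balaban1985UV3, (71) p.273] -/
theorem wedgeTailL_face_one :
    ∀ (L : ℕ) (b₁ p₁ : ℝ), ∃ (b₀ p₀ : ℝ), b₁ ≤ b₀ ∧ p₁ ≤ p₀ ∧ 0 < b₀ ∧ 2 < p₀ ∧
      ∃ γ₁ : ℝ, 0 < γ₁ ∧ γ₁ ≤ 1 ∧ ∀ (F : T3Family) (γ : ℝ), F.L = L → 0 < γ → γ ≤ γ₁ →
        ∃ (D ρ : ℝ), 0 ≤ D ∧ 0 ≤ ρ ∧ ρ * (L : ℝ) ^ 3 < 1 ∧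
          ∀ (K j : ℕ), 1 ≤ j → j ≤ K → K ≤ 1 * (K - j + 1) → ∀ (p : Plaq (F.P K) j),
            (T3UnitScaleTilt.gibbsK F T3UnitLawDensityEML.ℰp γ K).real
                {U | T3UnitScaleTilt.θBal F.L γ b₀ p₀ (K - j) ≤
                  GaugeGroup.dist1 (GaugeField.plaqHol
                    (Averaging.iter (fun i => BlockAveraging.blockAvg (P := F.P K) (j := i) T3UnitLawDensityEML.ℰp) j U) p)} ≤
              D * ρ ^ (K - j) := by
  intro L b₁ p₁
  refine ⟨max b₁ 1, max p₁ 3, le_max_left _ _, le_max_left _ _, lt_of_lt_of_le one_pos (le_max_right _ _),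
    lt_of_lt_of_le (by norm_num) (le_max_right _ _), 1, one_pos, le_rfl, fun F γ hFL hγ hγ1 => ?_⟩
  subst hFL
  exact wedgeTailAt_one F hγ hγ1 (lt_of_lt_of_le one_pos (le_max_right _ _)) (by linarith [le_max_right p₁ 3])

end Summit.QuantumFields.YangMills.Theorems.HistoryWedgeCornerOne

end
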